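import Literature.Analysis.FluidPDE.JiaSverak2014DatumContinuation
import Literature.Analysis.FluidPDE.JiaSverak2014SlabAprioriEstimate
import Literature.Analysis.FluidPDE.CKNEpsilonRegularityHolds
import HarnessLib

/-!
# Jia–Šverák 2014, §4 claim: boundedness of a Leray solution near the initial time where the
  datum is smooth

Analysis/FluidPDE proofs file (theorems only, no definitions, no named facts), second file of
the proof of the named fact `Literature.Analysis.FluidPDE.jia_sverak_2014_local_higher_regularity`
(`JiaSverak2014LocalRegularity.lean`; H. Jia, V. Šverák, Invent. Math. 196 (2014) =
arXiv:1204.0529, §4, proof of Thm. 4.1: "since `u₀ ∈ C^∞(B₄(x₀))`, we can apply Theorem 3.1 and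
some simple bootstrapping arguments [...]"). It proves the **order-zero** part of that claim in
the general-data reading of the fact — a Leray solution is *essentially bounded near the initial
time* on a neighbourhood of a centre where the datum is smooth, with a time of validity and a
bound depending only on the uniformly local energy `α` of the datum and on the size of the datum
and of two of its derivatives near the centre:

* `JiaSverak2014.exists_ae_norm_le_near_initial_time` — for all `α : ℝ≥0`, `A₀`, `F₀` there are
  `T₁ > 0` and `K` such that: for every local Leray solution `(u, p)` on a slab `(0, T') × ℝ³`
  (`IsLocalLeraySolutionOn T' 1 u₀ u p`, Lemarié-Rieusset 2016, Def. 14.1) with measurable datum,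
  `∫_{B₁(y)} |u₀|² ≤ α` for all `y`, every centre `x₀` and every `C²` field `e` which agrees with
  `u₀` and is divergence free on `B_{15/4}(x₀)` with `|e| ≤ A₀`, `|(e·∇)e - Δe| ≤ F₀` there,
  `|u| ≤ K` a.e. on `(0, min(T₁, T')) × B₃(x₀)`.

(For the datum of the fact, smooth on `B₄(x₀)` with `‖Dⁿu₀‖ ≤ A n`, such an `e` is a smooth
cut-off of `u₀`, with `A₀ = A 0`, `F₀ = A 0 · A 1 + 3 A 2`; this instantiation belongs to the
assembly of the fact.)

## The argument

Jia–Šverák prove regularity up to `t = 0` (proof of Thm. 3.1, arXiv p. 8) by extending the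
perturbation `v = u - a` by zero to negative times and applying an ε-regularity theorem for the
*perturbed* system on unit cylinders reaching across `t = 0`. Here the Leray solution itself is
continued to negative times by the steady field `e` (pressure `0`, force
`f₀ = (e·∇)e - Δe`): by `JiaSverak2014DatumContinuation.lean` the continued pair is a suitable weak
solution of the **forced** Navier–Stokes system on `Q = (-1, T₀) × B_{15/4}(x₀)`, and the tree's
proved ε-regularity theorem **with force** — Lemarié-Rieusset 2016, Thm. 14.4
(`lemarieRieusset_epsilon_regularity_holds`, here `ν = 1`, `q = 3`, threshold `ε₀`, constant
`C₀`) — applies on the cylinders `Q_r(t, x)`, `0 < t ≤ T₀`, `x ∈ B_{13/4}(x₀)`, of the **fixed**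
radius `r = min(1/2, ε₀/(2(|B₁|+1)(|A₀|+|F₀|+1)))`:

* the steady half of `Q_r(t,x)` contributes `≤ A₀³ |Q_r| ≤ ε₀³ r²/2` to `∫∫ (|ū|³ + |p̄|^{3/2})`
  and `≤ F₀³ |Q_r| ≤ ε₀⁶ r⁻⁴` to `∫∫ |f̄|³` (`lintegral_cylinder_velocity_pressure_le`,
  `lintegral_cylinder_force_le`, and the choice of `r`);
* the Leray half contributes `≤ (2K_c + P₀) M^{3/2} t^{1/4} ≤ ε₀³ r²/2` for `t ≤ T₁`, by the a
  priori estimate of Lemma 3.1 on the slab (`apriori_unit_scale_slab`, `M = 2Cα`; the pressure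
  renormalised by the gauge of the local pressure expansion at the centre `x`,
  `IsLocalLeraySolutionOn.exists_measurable_gauge`, `.sub_pressure`) and the window bounds
  `exists_lintegral_cube_window_le_slab`, `exists_window_pressure_bound_slab`;

so `|u| ≤ C₀ε₀/r =: K` a.e. on `Q_{r/2}(t, x)`, and the cylinders with rational `t` and centres in a
countable dense set cover `(0, T₀) × B₃(x₀)`.

## Mathlib / tree search

Tree (all used): `lemarieRieusset_epsilon_regularity_holds` (`CKNEpsilonRegularityHolds`), the
continuation package `JiaSverak2014.isConnected_Q`, `exists_energyClass_Q`,
`hasWeakSpatialGradientOn_Q`, `lintegral_Gc_sq_lt_top`, `lintegral_pc_lt_top`, `memLp_fc`,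
`isDistributionalNSSolutionOn_Q`, `localEnergyIneq_Q` (`JiaSverak2014DatumContinuation`),
`apriori_unit_scale_slab`, `exists_lintegral_cube_window_le_slab`,
`exists_window_pressure_bound_slab`, `IsLocalLeraySolutionOn.sub_pressure`
(`JiaSverak2014SlabAprioriEstimate`), `IsLocalLeraySolutionOn.exists_measurable_gauge`
(`JiaSverak2014SlabPressureGauge`), `LocalEnergyConcat.setLIntegral_split_le`. Mathlib:
`Measure.addHaar_ball`, `ae_ball_iff`, `TopologicalSpace.exists_countable_dense`,
`Dense.exists_dist_lt`, `exists_rat_btwn`.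

## References

* H. Jia, V. Šverák, Invent. Math. 196 (2014) 233–265 = arXiv:1204.0529: §3, Lemma 3.1 and the
  proof of Thm. 3.1 (arXiv pp. 7–9); §4, proof of Thm. 4.1 (the claim for `|x₀| = 8`).
  Bib key `JiaSverak2014`.
* P. G. Lemarié-Rieusset, *The Navier–Stokes Problem in the 21st Century*, CRC Press (2016),
  Thm. 14.4 (p. 505); Def. 14.1. Bib key `LemarieRieusset2016`.
* K. Kang, H. Miura, T.-P. Tsai, IMRN 2021 = arXiv:1812.10509, Lemma 3.4 (pressure expansion);
  Partial Differ. Equ. Appl. 2 (2021) = arXiv:2106.03980, Thm. 1.2 (the `L^q`-data version of the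
  order-zero statement). Bib keys `KangMiuraTsai2020`, `KangMiuraTsai2021`.
-/

noncomputable section

open MeasureTheory TopologicalSpace Set Function Filter Metric
open _root_.Topology
open scoped ENNReal NNReal RealInnerProductSpace Laplacian ContDiff

namespace Literature.Analysis.FluidPDE

namespace JiaSverak2014

open LocalEnergyConcat

/-! ## §C. The scaled functionals of the continued pair on a cylinder reaching across `t = 0` -/

section Cylinder

variable {e : EuclideanSpace ℝ (Fin 3) → EuclideanSpace ℝ (Fin 3)}
  {u uc fc : ℝ → EuclideanSpace ℝ (Fin 3) → EuclideanSpace ℝ (Fin 3)}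
  {p pc : ℝ → EuclideanSpace ℝ (Fin 3) → ℝ}

/-- The volume of the unit ball of `ℝ³`, as a real number. [folklore] -/
theorem volume_ball_eq (x : EuclideanSpace ℝ (Fin 3)) {r : ℝ} (hr : 0 ≤ r) :
    volume (ball x r) = ENNReal.ofReal (r ^ 3) * volume (ball (0 : EuclideanSpace ℝ (Fin 3)) 1) := by
  rw [Measure.addHaar_ball volume x hr, finrank_euclideanSpace_fin]

/-- The volume of a parabolic cylinder: `|Q_r(z)| = r² · r³ |B₁|`. [folklore] -/
theorem volume_parabolicCylinder (z : ℝ × EuclideanSpace ℝ (Fin 3)) {r : ℝ} (hr : 0 ≤ r) :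
    volume (FluidPDE.parabolicCylinder r z) =
      ENNReal.ofReal (r ^ 2 * r ^ 3) * volume (ball (0 : EuclideanSpace ℝ (Fin 3)) 1) := by
  rw [FluidPDE.parabolicCylinder, Measure.volume_eq_prod, Measure.prod_prod, Real.volume_Ioo,
    volume_ball_eq z.2 hr, ← mul_assoc, show z.1 - (z.1 - r ^ 2) = r ^ 2 by ring,
    ← ENNReal.ofReal_mul (sq_nonneg _)]

/-- A bounded function integrates to at most `bound × volume` over the lower half of a parabolic
cylinder. [folklore] -/
theorem lintegral_cylinder_lower_le {g : ℝ × EuclideanSpace ℝ (Fin 3) → ℝ≥0∞} {B : ℝ≥0∞}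
    (z : ℝ × EuclideanSpace ℝ (Fin 3)) {r : ℝ} (hr : 0 ≤ r)
    (hg : ∀ w ∈ FluidPDE.parabolicCylinder r z, g w ≤ B) :
    ∫⁻ w in FluidPDE.parabolicCylinder r z ∩ {w | w.1 < 0}, g w ≤
      B * (ENNReal.ofReal (r ^ 2 * r ^ 3) * volume (ball (0 : EuclideanSpace ℝ (Fin 3)) 1)) := by
  calc ∫⁻ w in FluidPDE.parabolicCylinder r z ∩ {w | w.1 < 0}, g w
      ≤ ∫⁻ w in FluidPDE.parabolicCylinder r z, g w := lintegral_mono_set inter_subset_left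
    _ ≤ ∫⁻ _ in FluidPDE.parabolicCylinder r z, B :=
        setLIntegral_mono measurable_const hg
    _ = B * (ENNReal.ofReal (r ^ 2 * r ^ 3) * volume (ball (0 : EuclideanSpace ℝ (Fin 3)) 1)) := by
        rw [setLIntegral_const, volume_parabolicCylinder z hr]

/-- The upper half of a parabolic cylinder hanging from a time `t > 0` lies in the box
`(0, t) × B_r(x)`. [folklore] -/
theorem parabolicCylinder_inter_lt_fst_subset (t : ℝ) (x : EuclideanSpace ℝ (Fin 3)) (r : ℝ) :
    FluidPDE.parabolicCylinder r (t, x) ∩ {w : ℝ × EuclideanSpace ℝ (Fin 3) | 0 < w.1} ⊆ Ioo 0 t ×ˢ ball x r := by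
  intro w hw
  rw [mem_inter_iff, FluidPDE.mem_parabolicCylinder] at hw
  exact ⟨⟨hw.2, hw.1.1.2⟩, hw.1.2⟩

/-- **The velocity–pressure functional of the continued pair on a cylinder across `t = 0`**:
the steady half contributes at most `A₀³ |Q_r|` (`|e| ≤ A₀` on the ball of the cylinder, zero
pressure), the Leray half at most the functional of `(u, p)` on the box `(0, t) × B_r(x)`.
[folklore] -/
theorem lintegral_cylinder_velocity_pressure_le {t r : ℝ} {x : EuclideanSpace ℝ (Fin 3)} (hr : 0 ≤ r)
    {A₀ : ℝ} (hA₀ : ∀ y ∈ ball x r, ‖e y‖ ≤ A₀)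
    (hu₁ : ∀ s, s ≤ 0 → uc s = e) (hu₂ : ∀ s, 0 < s → uc s = u s)
    (hp₁ : ∀ s, s ≤ 0 → pc s = 0) (hp₂ : ∀ s, 0 < s → pc s = p s) :
    ∫⁻ w in FluidPDE.parabolicCylinder r (t, x), (‖uc w.1 w.2‖ₑ ^ (3 : ℕ) + ‖pc w.1 w.2‖ₑ ^ (3 / 2 : ℝ)) ≤
      ENNReal.ofReal (A₀ ^ 3) * (ENNReal.ofReal (r ^ 2 * r ^ 3) * volume (ball (0 : EuclideanSpace ℝ (Fin 3)) 1)) +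
        ∫⁻ w in Ioo 0 t ×ˢ ball x r, (‖u w.1 w.2‖ₑ ^ (3 : ℕ) + ‖p w.1 w.2‖ₑ ^ (3 / 2 : ℝ)) := by
  refine (setLIntegral_split_le (FluidPDE.isOpen_parabolicCylinder r (t, x)).measurableSet (t₀ := 0)
    (f₁ := fun w : ℝ × EuclideanSpace ℝ (Fin 3) => ‖e w.2‖ₑ ^ (3 : ℕ))
    (f₂ := fun w : ℝ × EuclideanSpace ℝ (Fin 3) => ‖u w.1 w.2‖ₑ ^ (3 : ℕ) + ‖p w.1 w.2‖ₑ ^ (3 / 2 : ℝ))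
    (fun w hw => by
      simp only [hu₁ w.1 hw.le, hp₁ w.1 hw.le, Pi.zero_apply, enorm_zero,
        ENNReal.zero_rpow_of_pos (by norm_num : (0 : ℝ) < 3 / 2), add_zero])
    (fun w hw => by simp only [hu₂ w.1 hw, hp₂ w.1 hw])).trans ?_
  refine add_le_add ?_ (lintegral_mono_set (parabolicCylinder_inter_lt_fst_subset t x r))
  refine lintegral_cylinder_lower_le (t, x) hr fun w hw => ?_
  rw [FluidPDE.mem_parabolicCylinder] at hw
  have h1 : ‖e w.2‖ₑ ≤ ENNReal.ofReal A₀ := by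
    rw [← ofReal_norm]
    exact ENNReal.ofReal_le_ofReal (hA₀ w.2 hw.2)
  calc ‖e w.2‖ₑ ^ (3 : ℕ) ≤ ENNReal.ofReal A₀ ^ (3 : ℕ) := by gcongr
    _ = ENNReal.ofReal (A₀ ^ 3) := by
        rw [ENNReal.ofReal_pow ((norm_nonneg _).trans (hA₀ w.2 hw.2))]

set_option maxHeartbeats 800000 in
/-- **The force functional of the continued pair on a cylinder across `t = 0`**: only the steady
half carries the force, bounded by `F₀` on the ball of the cylinder. [folklore] -/
theorem lintegral_cylinder_force_le {t r : ℝ} {x : EuclideanSpace ℝ (Fin 3)} (hr : 0 ≤ r)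
    {f₀ : EuclideanSpace ℝ (Fin 3) → EuclideanSpace ℝ (Fin 3)}
    {F₀ : ℝ} (hF₀ : ∀ y ∈ ball x r, ‖f₀ y‖ ≤ F₀)
    (hf₁ : ∀ s, s ≤ 0 → fc s = f₀) (hf₂ : ∀ s, 0 < s → fc s = 0) :
    ∫⁻ w in FluidPDE.parabolicCylinder r (t, x), ‖fc w.1 w.2‖ₑ ^ (3 : ℝ) ≤
      ENNReal.ofReal (F₀ ^ 3) * (ENNReal.ofReal (r ^ 2 * r ^ 3) * volume (ball (0 : EuclideanSpace ℝ (Fin 3)) 1)) := by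
  have hsplit := setLIntegral_split_le (FluidPDE.isOpen_parabolicCylinder r (t, x)).measurableSet (t₀ := 0)
    (f := fun w : ℝ × EuclideanSpace ℝ (Fin 3) => ‖fc w.1 w.2‖ₑ ^ (3 : ℝ))
    (f₁ := fun w : ℝ × EuclideanSpace ℝ (Fin 3) => ‖f₀ w.2‖ₑ ^ (3 : ℝ))
    (f₂ := fun _ : ℝ × EuclideanSpace ℝ (Fin 3) => (0 : ℝ≥0∞))
    (fun w hw => by simp only [hf₁ w.1 hw.le])
    (fun w hw => by
      have h0 : fc w.1 w.2 = 0 := by rw [hf₂ w.1 hw]; rfl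
      rw [h0, enorm_zero]
      exact ENNReal.zero_rpow_of_pos (by norm_num))
  rw [setLIntegral_const, zero_mul, add_zero] at hsplit
  refine hsplit.trans (lintegral_cylinder_lower_le (t, x) hr fun w hw => ?_)
  rw [FluidPDE.mem_parabolicCylinder] at hw
  have hF : 0 ≤ F₀ := (norm_nonneg _).trans (hF₀ w.2 hw.2)
  have h1 : ‖f₀ w.2‖ₑ ≤ ENNReal.ofReal F₀ := by
    rw [← ofReal_norm]
    exact ENNReal.ofReal_le_ofReal (hF₀ w.2 hw.2)
  calc ‖f₀ w.2‖ₑ ^ (3 : ℝ) ≤ ENNReal.ofReal F₀ ^ (3 : ℝ) := ENNReal.rpow_le_rpow h1 (by norm_num)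
    _ = ENNReal.ofReal (F₀ ^ 3) := by
        rw [ENNReal.ofReal_rpow_of_nonneg hF (by norm_num)]
        norm_num

end Cylinder

/-! ## §D. Boundedness near the initial time -/

section Main

/-- Elementary: if `r c ≤ ε` with `c ≥ 2 (V + 1)(a + 1)`, `a, V ≥ 0`, `0 ≤ r`, then
`a³ V r³ ≤ ε³ / 2`. [folklore] -/
theorem cube_bound_aux {r c ε a V : ℝ} (hr : 0 ≤ r) (ha : 0 ≤ a) (hV : 0 ≤ V)
    (hc : 2 * (V + 1) * (a + 1) ≤ c) (hrc : r * c ≤ ε) :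
    a ^ 3 * V * r ^ 3 ≤ ε ^ 3 / 2 := by
  -- `b = 2 r (V+1)(a+1) ≤ ε`, and `a³ V r³ ≤ (b/2)³ = b³/8`
  set b : ℝ := r * (2 * (V + 1) * (a + 1)) with hb
  have hb0 : 0 ≤ b := by positivity
  have hbε : b ≤ ε := (mul_le_mul_of_nonneg_left hc hr).trans hrc
  have hε0 : 0 ≤ ε := hb0.trans hbε
  have h1 : a ^ 3 * V * r ^ 3 ≤ (r * ((V + 1) * (a + 1))) ^ 3 := by
    have h2 : a ^ 3 * V ≤ ((V + 1) * (a + 1)) ^ 3 := by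
      have h3 : a ^ 3 ≤ (a + 1) ^ 3 := by gcongr; linarith
      have h4 : V ≤ (V + 1) ^ 3 := by
        calc V ≤ V + 1 := by linarith
          _ ≤ (V + 1) ^ 3 := le_self_pow₀ (by linarith) (by norm_num)
      calc a ^ 3 * V ≤ (a + 1) ^ 3 * (V + 1) ^ 3 := by gcongr
        _ = ((V + 1) * (a + 1)) ^ 3 := by ring
    calc a ^ 3 * V * r ^ 3 = (a ^ 3 * V) * r ^ 3 := by ring
      _ ≤ ((V + 1) * (a + 1)) ^ 3 * r ^ 3 := by gcongr
      _ = (r * ((V + 1) * (a + 1))) ^ 3 := by ring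
  have h5 : (r * ((V + 1) * (a + 1))) ^ 3 = b ^ 3 / 8 := by rw [hb]; ring
  have h6 : b ^ 3 ≤ ε ^ 3 := by gcongr
  nlinarith [h1, h5, h6, pow_nonneg hε0 3]

/-- Elementary: if `r c ≤ ε` with `c ≥ 2 (V + 1)(a + 1)`, `a, V ≥ 0`, `0 ≤ r ≤ 1`, then
`a³ V r⁹ ≤ ε⁶`. [folklore] -/
theorem ninth_bound_aux {r c ε a V : ℝ} (hr : 0 ≤ r) (hr1 : r ≤ 1) (ha : 0 ≤ a) (hV : 0 ≤ V)
    (hc : 2 * (V + 1) * (a + 1) ≤ c) (hrc : r * c ≤ ε) :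
    a ^ 3 * V * r ^ 9 ≤ ε ^ 6 := by
  set b : ℝ := r * (2 * (V + 1) * (a + 1)) with hb
  have hb0 : 0 ≤ b := by positivity
  have hbε : b ≤ ε := (mul_le_mul_of_nonneg_left hc hr).trans hrc
  have h1 : a ^ 3 * V ≤ ((V + 1) * (a + 1)) ^ 6 := by
    have hA1 : 1 ≤ a + 1 := by linarith
    have hV1 : 1 ≤ V + 1 := by linarith
    have h3 : a ^ 3 ≤ (a + 1) ^ 6 := by
      calc a ^ 3 ≤ (a + 1) ^ 3 := by gcongr; linarith
        _ ≤ (a + 1) ^ 6 := pow_le_pow_right₀ hA1 (by norm_num)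
    have h4 : V ≤ (V + 1) ^ 6 := by
      calc V ≤ (V + 1) ^ 1 := by rw [pow_one]; linarith
        _ ≤ (V + 1) ^ 6 := pow_le_pow_right₀ hV1 (by norm_num)
    calc a ^ 3 * V ≤ (a + 1) ^ 6 * (V + 1) ^ 6 := by gcongr
      _ = ((V + 1) * (a + 1)) ^ 6 := by ring
  have h2 : r ^ 9 ≤ r ^ 6 := pow_le_pow_of_le_one hr hr1 (by norm_num)
  calc a ^ 3 * V * r ^ 9 ≤ ((V + 1) * (a + 1)) ^ 6 * r ^ 6 := by gcongr
    _ = b ^ 6 / 64 := by rw [hb]; ring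
    _ ≤ b ^ 6 := by nlinarith [pow_nonneg hb0 6]
    _ ≤ ε ^ 6 := by gcongr

set_option maxHeartbeats 1600000 in
/-- **Jia–Šverák 2014, §4 claim, order zero (general-data reading): a Leray solution is bounded
near the initial time where the datum is smooth**, with bounds depending only on the size of the
datum. Precisely: for all `α : ℝ≥0` and `A₀, F₀` there are `T₁ > 0` and `K` such that for every
local Leray solution `(u, p)` on a slab `(0, T') × ℝ³` (`IsLocalLeraySolutionOn T' 1 u₀ u p`) with
measurable datum satisfying `∫_{B₁(y)} |u₀|² ≤ α` for all `y`, every centre `x₀` and every `C²`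
field `e` which agrees with `u₀` and is divergence free on `B_{15/4}(x₀)`, with `|e| ≤ A₀` and
`|(e·∇)e - Δe| ≤ F₀` there, one has `|u| ≤ K` a.e. on `(0, min(T₁, T')) × B₃(x₀)`.

Proof (the route of the proof of Thm. 3.1, arXiv p. 8, with the extension by the datum instead of
the extension of the perturbation by zero): the continued pair of
`JiaSverak2014DatumContinuation.lean` is a suitable weak solution of the Navier–Stokes system with
the bounded force `1_{t<0}((e·∇)e - Δe)` on `Q = (-1, T₀) × B_{15/4}(x₀)`, `T₀ = min(T₁, T')`
(pressure renormalised by the gauge `c_x(t)` of the local pressure expansion at the centre of each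
cylinder, `IsLocalLeraySolutionOn.exists_measurable_gauge`, `.sub_pressure`); Lemarié-Rieusset's
ε-regularity theorem with force (2016, Thm. 14.4, `lemarieRieusset_epsilon_regularity_holds`,
`ν = 1`, `q = 3`, smallness threshold `ε₀`, constant `C₀`) is applied on the cylinders
`Q_r(t, x)`, `x ∈ B_{13/4}(x₀)`, `0 < t ≤ T₀`, of the **fixed** radius
`r = min(1/2, ε₀ / (2(|B₁|+1)(|A₀|+|F₀|+1)))`: the steady half of the cylinder contributes
`A₀³ |Q_r| ≤ ε₀³ r²/2` to `∫∫(|ū|³ + |p̄|^{3/2})` and `F₀³ |Q_r| ≤ ε₀⁶ r⁻⁴` to `∫∫ |f̄|³`, the Leray half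
at most `(2K_c + P₀) M^{3/2} t^{1/4} ≤ ε₀³ r²/2` for `t ≤ T₁` by the a priori estimate of Lemma 3.1
(`apriori_unit_scale_slab`, `M = 2Cα`) with the window bounds
`exists_lintegral_cube_window_le_slab`, `exists_window_pressure_bound_slab`; hence `|u| ≤ C₀ε₀/r`
a.e. on `Q_{r/2}(t, x)`, and these cylinders with rational `t` and centres in a countable dense set
cover `(0, T₀) × B₃(x₀)`.
[cite: JiaSverak2014, §4 proof of Thm. 4.1 (the claim for |x₀| = 8, order zero) with §3 proof of Thm. 3.1 (arXiv pp. 8–9)] -/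
theorem exists_ae_norm_le_near_initial_time (α : ℝ≥0) (A₀ F₀ : ℝ) :
    ∃ T₁ : ℝ, 0 < T₁ ∧ ∃ K : ℝ,
      ∀ (u₀ : EuclideanSpace ℝ (Fin 3) → EuclideanSpace ℝ (Fin 3)) (x₀ : EuclideanSpace ℝ (Fin 3))
        (T' : ℝ) (u : ℝ → EuclideanSpace ℝ (Fin 3) → EuclideanSpace ℝ (Fin 3))
        (p : ℝ → EuclideanSpace ℝ (Fin 3) → ℝ) (e : EuclideanSpace ℝ (Fin 3) → EuclideanSpace ℝ (Fin 3)),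
        AEStronglyMeasurable u₀ volume →
        (∀ y : EuclideanSpace ℝ (Fin 3), ∫⁻ x in ball y 1, ‖u₀ x‖ₑ ^ 2 ≤ (α : ℝ≥0∞)) →
        0 < T' → IsLocalLeraySolutionOn T' 1 u₀ u p →
        ContDiff ℝ 2 e → (∀ x ∈ ball x₀ (15 / 4), e x = u₀ x) →
        (∀ x ∈ ball x₀ (15 / 4), VectorCalculus.divergence e x = 0) →
        (∀ x ∈ ball x₀ (15 / 4), ‖e x‖ ≤ A₀) →
        (∀ x ∈ ball x₀ (15 / 4), ‖convect e e x - (Δ e) x‖ ≤ F₀) →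
        ∀ᵐ z ∂(volume.restrict (Ioo 0 (min T₁ T') ×ˢ ball x₀ 3)), ‖u z.1 z.2‖ ≤ K := by
  -- ## universal constants
  obtain ⟨ε₀, C₀, hε₀, hC₀, hLR⟩ := lemarieRieusset_epsilon_regularity_holds 1 3 one_pos (by norm_num)
  obtain ⟨εₐ, hεₐ, -, Cₐ, hAP⟩ := apriori_unit_scale_slab
  obtain ⟨Kc, hKc⟩ := exists_lintegral_cube_window_le_slab 1
  obtain ⟨P₀, hP₀⟩ := exists_window_pressure_bound_slab
  -- the unit-ball volume
  set V₁e : ℝ≥0∞ := volume (ball (0 : EuclideanSpace ℝ (Fin 3)) 1) with hV₁e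
  have hV₁top : V₁e ≠ ⊤ := measure_ball_lt_top.ne
  set V₁ : ℝ := V₁e.toReal with hV₁
  have hV₁0 : 0 ≤ V₁ := ENNReal.toReal_nonneg
  have hV₁eq : V₁e = ENNReal.ofReal V₁ := (ENNReal.ofReal_toReal hV₁top).symm
  -- the radius
  set cA : ℝ := 2 * (V₁ + 1) * (|A₀| + |F₀| + 1) with hcA
  have hcA0 : 0 < cA := by positivity
  set r : ℝ := min (1 / 2) (ε₀ / cA) with hr
  have hr0 : 0 < r := lt_min (by norm_num) (div_pos hε₀ hcA0)
  have hr12 : r ≤ 1 / 2 := min_le_left _ _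
  have hr1 : r ≤ 1 := hr12.trans (by norm_num)
  have hrc : r * cA ≤ ε₀ := by
    calc r * cA ≤ ε₀ / cA * cA := mul_le_mul_of_nonneg_right (min_le_right _ _) hcA0.le
      _ = ε₀ := div_mul_cancel₀ _ hcA0.ne'
  have hcA_A : 2 * (V₁ + 1) * (|A₀| + 1) ≤ cA := by
    rw [hcA]; gcongr; linarith [abs_nonneg F₀]
  have hcA_F : 2 * (V₁ + 1) * (|F₀| + 1) ≤ cA := by
    rw [hcA]; gcongr; linarith [abs_nonneg A₀]
  have hA3 : |A₀| ^ 3 * V₁ * r ^ 3 ≤ ε₀ ^ 3 / 2 := cube_bound_aux hr0.le (abs_nonneg _) hV₁0 hcA_A hrc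
  have hF9 : |F₀| ^ 3 * V₁ * r ^ 9 ≤ ε₀ ^ 6 := ninth_bound_aux hr0.le hr1 (abs_nonneg _) hV₁0 hcA_F hrc
  -- the window coefficient
  set M : ℝ≥0 := 2 * Cₐ * α with hM
  set Wtop : ℝ≥0∞ := (2 * (Kc : ℝ≥0∞) + P₀) * (M : ℝ≥0∞) ^ (3 / 2 : ℝ) with hWtop
  have hWtop_ne : Wtop ≠ ⊤ :=
    ENNReal.mul_ne_top (by simp [ENNReal.mul_eq_top, ENNReal.add_eq_top])
      (ENNReal.rpow_ne_top_of_nonneg (by norm_num) ENNReal.coe_ne_top)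
  set W : ℝ := Wtop.toReal with hW
  have hW0 : 0 ≤ W := ENNReal.toReal_nonneg
  have hWeq : Wtop = ENNReal.ofReal W := (ENNReal.ofReal_toReal hWtop_ne).symm
  -- the time
  set θ : ℝ := ε₀ ^ 3 * r ^ 2 / 2 with hθ
  have hθ0 : 0 < θ := by positivity
  set τ : ℝ := (θ / (W + 1)) ^ 4 with hτ
  have hτ0 : 0 < τ := by positivity
  set T₁ : ℝ := min (min (εₐ : ℝ) ((εₐ : ℝ) / ((α : ℝ) ^ 2 + 1))) (min 1 τ) with hT₁
  have hT₁0 : 0 < T₁ := lt_min (lt_min (by exact_mod_cast hεₐ) (by positivity)) (lt_min one_pos hτ0)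
  refine ⟨T₁, hT₁0, C₀ * ε₀ / r, ?_⟩
  intro u₀ x₀ T' u p e hm₀ hα hT' h he heu hdiv hA₀ hF₀
  have he1 : ContDiff ℝ 1 e := he.of_le one_le_two
  -- the time level
  set T₀ : ℝ := min T₁ T' with hT₀
  have hT₀0 : 0 < T₀ := lt_min hT₁0 hT'
  have hT₀T : T₀ ≤ T' := min_le_right _ _
  have hT₀1 : T₀ ≤ 1 := (min_le_left _ _).trans ((min_le_right _ _).trans (min_le_left _ _))
  have hT₀τ : T₀ ≤ τ := (min_le_left _ _).trans ((min_le_right _ _).trans (min_le_right _ _))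
  have hT₀ε : T₀ ≤ (εₐ : ℝ) := (min_le_left _ _).trans ((min_le_left _ _).trans (min_le_left _ _))
  have hT₀α : T₀ * (α : ℝ) ^ 2 ≤ (εₐ : ℝ) := by
    have h1 : T₀ ≤ (εₐ : ℝ) / ((α : ℝ) ^ 2 + 1) :=
      (min_le_left _ _).trans ((min_le_left _ _).trans (min_le_right _ _))
    calc T₀ * (α : ℝ) ^ 2 ≤ (εₐ : ℝ) / ((α : ℝ) ^ 2 + 1) * ((α : ℝ) ^ 2 + 1) :=
          mul_le_mul h1 (by linarith) (sq_nonneg _) (by positivity)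
      _ = (εₐ : ℝ) := div_mul_cancel₀ _ (by positivity)
  -- nonnegativity of the data bounds
  have hA00 : 0 ≤ A₀ := (norm_nonneg _).trans (hA₀ x₀ (mem_ball_self (by norm_num)))
  have hF00 : 0 ≤ F₀ := (norm_nonneg _).trans (hF₀ x₀ (mem_ball_self (by norm_num)))
  rw [abs_of_nonneg hA00] at hA3
  rw [abs_of_nonneg hF00] at hF9
  -- ## the a priori estimate on `(0, T₀)`
  obtain ⟨G, hG, hGb⟩ := h.uniformLocalGradient
  have hα2 : ∀ y : EuclideanSpace ℝ (Fin 3), ∫⁻ x in ball y 1, ‖u₀ x‖ₑ ^ 2 ≤ 2 * (α : ℝ≥0∞) := fun y =>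
    (hα y).trans (by
      calc (α : ℝ≥0∞) = 1 * α := (one_mul _).symm
        _ ≤ 2 * α := by gcongr; norm_num)
  obtain ⟨hE, hD, -⟩ := hAP u₀ u p G α T' T₀ hm₀ h hG hα2 hT₀0 hT₀T hT₀ε hT₀α
  have hME : 2 * ((Cₐ * α : ℝ≥0) : ℝ≥0∞) = (M : ℝ≥0∞) := by
    rw [hM]; push_cast; ring
  have hMD : ((Cₐ * α : ℝ≥0) : ℝ≥0∞) ≤ (M : ℝ≥0∞) := by
    rw [← hME]
    calc ((Cₐ * α : ℝ≥0) : ℝ≥0∞) = 1 * ((Cₐ * α : ℝ≥0) : ℝ≥0∞) := (one_mul _).symm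
      _ ≤ 2 * ((Cₐ * α : ℝ≥0) : ℝ≥0∞) := by gcongr; norm_num
  -- ## the key step: boundedness on one cylinder
  have key : ∀ (t : ℝ) (x : EuclideanSpace ℝ (Fin 3)), t ∈ Ioc 0 T₀ → x ∈ ball x₀ (13 / 4) →
      ∀ᵐ w ∂(volume : Measure (ℝ × EuclideanSpace ℝ (Fin 3))),
        w ∈ FluidPDE.parabolicCylinder (r / 2) (t, x) → 0 < w.1 → ‖u w.1 w.2‖ ≤ C₀ * ε₀ / r := by
    intro t x ht hx
    -- the gauge at the centre and the renormalised pressure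
    obtain ⟨c, hcm, hcL, hdec, hcfin⟩ := h.exists_measurable_gauge x
    have hq : IsLocalLeraySolutionOn T' 1 u₀ u (fun s y => p s y - c s) := h.sub_pressure hcm hcL hcfin
    -- the continued fields
    obtain ⟨uc, huc⟩ : ∃ uc : ℝ → EuclideanSpace ℝ (Fin 3) → EuclideanSpace ℝ (Fin 3),
        uc = fun s y => if s ≤ 0 then e y else u s y := ⟨_, rfl⟩
    obtain ⟨pc, hpc⟩ : ∃ pc : ℝ → EuclideanSpace ℝ (Fin 3) → ℝ,
        pc = fun s y => if s ≤ 0 then (0 : ℝ) else p s y - c s := ⟨_, rfl⟩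
    obtain ⟨fc, hfc⟩ : ∃ fc : ℝ → EuclideanSpace ℝ (Fin 3) → EuclideanSpace ℝ (Fin 3),
        fc = fun s y => if s ≤ 0 then convect e e y - (Δ e) y else 0 := ⟨_, rfl⟩
    obtain ⟨Gc, hGc⟩ : ∃ Gc : ℝ → EuclideanSpace ℝ (Fin 3) → EuclideanSpace ℝ (Fin 3) →L[ℝ] EuclideanSpace ℝ (Fin 3),
        Gc = fun s y => if s ≤ 0 then fderiv ℝ e y else G s y := ⟨_, rfl⟩
    have hu₁ : ∀ s, s ≤ 0 → uc s = e := fun s hs => by funext y; simp [huc, hs]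
    have hu₂ : ∀ s, 0 < s → uc s = u s := fun s hs => by funext y; simp [huc, not_le.2 hs]
    have hp₁ : ∀ s, s ≤ 0 → pc s = 0 := fun s hs => by funext y; simp [hpc, hs]
    have hp₂ : ∀ s, 0 < s → pc s = fun y => p s y - c s := fun s hs => by
      funext y; simp [hpc, not_le.2 hs]
    have hf₁ : ∀ s, s ≤ 0 → fc s = fun y => convect e e y - (Δ e) y := fun s hs => by
      funext y; simp [hfc, hs]
    have hf₂ : ∀ s, 0 < s → fc s = 0 := fun s hs => by funext y; simp [hfc, not_le.2 hs]
    have hG₁ : ∀ s, s ≤ 0 → Gc s = fderiv ℝ e := fun s hs => by funext y; simp [hGc, hs]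
    have hG₂ : ∀ s, 0 < s → Gc s = G s := fun s hs => by funext y; simp [hGc, not_le.2 hs]
    -- geometry: the cylinder of radius `r` at `(t, x)` lies in `Q = (-1, T₀) × B_{15/4}(x₀)`
    have hρ : (0 : ℝ) < 15 / 4 := by norm_num
    have hballr : ball x r ⊆ ball x₀ (15 / 4) := by
      intro y hy
      rw [mem_ball] at hy hx ⊢
      calc dist y x₀ ≤ dist y x + dist x x₀ := dist_triangle _ _ _
        _ < r + 13 / 4 := add_lt_add hy hx
        _ ≤ 15 / 4 := by linarith
    have hcyl : FluidPDE.parabolicCylinder r (t, x) ⊆ Ioo (-1 : ℝ) T₀ ×ˢ ball x₀ (15 / 4) := by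
      intro w hw
      rw [FluidPDE.mem_parabolicCylinder] at hw
      refine ⟨⟨?_, hw.1.2.trans_le ht.2⟩, hballr hw.2⟩
      have : t - r ^ 2 < w.1 := hw.1.1
      nlinarith [ht.1]
    have hA₀' : ∀ y ∈ ball x₀ (15 / 4), ‖e y‖ ≤ (A₀.toNNReal : ℝ) := fun y hy =>
      (hA₀ y hy).trans (Real.le_coe_toNNReal A₀)
    -- ## smallness of the velocity–pressure functional
    have hsmall₁ : ∫⁻ w in FluidPDE.parabolicCylinder r (t, x),
        (‖uc w.1 w.2‖ₑ ^ (3 : ℕ) + ‖pc w.1 w.2‖ₑ ^ (3 / 2 : ℝ)) ≤ ENNReal.ofReal (ε₀ ^ 3 * r ^ 2) := by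
      have h1 := lintegral_cylinder_velocity_pressure_le (t := t) (e := e) (u := u) (uc := uc)
        (p := fun s y => p s y - c s) (pc := pc) hr0.le (fun y hy => hA₀ y (hballr hy)) hu₁ hu₂ hp₁ hp₂
      -- the Leray half through the window bounds
      have ht1 : t - 0 ≤ 1 := by linarith [ht.2.trans hT₀1]
      have htT : t ≤ T' := ht.2.trans hT₀T
      have hEt : ∀ᵐ s ∂(volume.restrict (Ioo 0 t)), ∀ z : EuclideanSpace ℝ (Fin 3),
          ∫⁻ y in ball z 1, ‖u s y‖ₑ ^ 2 ≤ (M : ℝ≥0∞) := by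
        have := ae_restrict_of_ae_restrict_of_subset (Ioo_subset_Ioo_right ht.2) hE
        filter_upwards [this] with s hs z
        rw [← hME]; exact hs z
      have hDt : ∀ z : EuclideanSpace ℝ (Fin 3), ∫⁻ w in Ioo 0 t ×ˢ ball z 1,
          ENNReal.ofReal (frobeniusNormSq (G w.1 w.2)) ≤ (M : ℝ≥0∞) := fun z =>
        ((lintegral_mono_set (prod_mono (Ioo_subset_Ioo_right ht.2) Subset.rfl)).trans (hD z)).trans hMD
      have hcube : ∫⁻ w in Ioo 0 t ×ˢ ball x 1, ‖u w.1 w.2‖ₑ ^ (3 : ℕ) ≤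
          2 * Kc * (M : ℝ≥0∞) ^ (3 / 2 : ℝ) * ENNReal.ofReal (t - 0) ^ (1 / 4 : ℝ) :=
        hKc u G T' 0 t x (M : ℝ≥0∞) le_rfl ht.1.le htT ht1 ENNReal.coe_ne_top hG
          ((hEt.mono fun s hs => hs x)) (hDt x)
      have hpress : ∫⁻ w in Ioo 0 t ×ˢ ball x 3, ‖p w.1 w.2 - c w.1‖ₑ ^ (3 / 2 : ℝ) ≤
          P₀ * (M : ℝ≥0∞) ^ (3 / 2 : ℝ) * ENNReal.ofReal (t - 0) ^ (1 / 4 : ℝ) :=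
        hP₀ h.aestronglyMeasurable h.aestronglyMeasurable_pressure (fun y ρ' => h.lintegral_cube_box_lt_top y ρ')
          hG le_rfl ht.1.le htT ht1 x hcm.aestronglyMeasurable hdec ENNReal.coe_ne_top le_rfl le_rfl hEt hDt
      have h2 : ∫⁻ w in Ioo 0 t ×ˢ ball x r, (‖u w.1 w.2‖ₑ ^ (3 : ℕ) + ‖p w.1 w.2 - c w.1‖ₑ ^ (3 / 2 : ℝ)) ≤
          Wtop * ENNReal.ofReal t ^ (1 / 4 : ℝ) := by
        have hmeas : AEMeasurable (fun w : ℝ × EuclideanSpace ℝ (Fin 3) => ‖u w.1 w.2‖ₑ ^ (3 : ℕ))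
            (volume.restrict (Ioo 0 t ×ˢ ball x r)) := by
          have hm := (h.aestronglyMeasurable.mono_measure (Measure.restrict_mono
            (prod_mono (Ioo_subset_Ioo_right htT) (subset_univ (ball x r))) le_rfl)).aemeasurable
          exact hm.enorm.pow_const _
        rw [sub_zero] at hcube hpress
        rw [lintegral_add_left' hmeas]
        calc (∫⁻ w in Ioo 0 t ×ˢ ball x r, ‖u w.1 w.2‖ₑ ^ (3 : ℕ)) +
              ∫⁻ w in Ioo 0 t ×ˢ ball x r, ‖p w.1 w.2 - c w.1‖ₑ ^ (3 / 2 : ℝ)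
            ≤ (∫⁻ w in Ioo 0 t ×ˢ ball x 1, ‖u w.1 w.2‖ₑ ^ (3 : ℕ)) +
              ∫⁻ w in Ioo 0 t ×ˢ ball x 3, ‖p w.1 w.2 - c w.1‖ₑ ^ (3 / 2 : ℝ) :=
              add_le_add (lintegral_mono_set (prod_mono Subset.rfl (ball_subset_ball hr1)))
                (lintegral_mono_set (prod_mono Subset.rfl (ball_subset_ball (by linarith))))
          _ ≤ 2 * Kc * (M : ℝ≥0∞) ^ (3 / 2 : ℝ) * ENNReal.ofReal t ^ (1 / 4 : ℝ) +
              P₀ * (M : ℝ≥0∞) ^ (3 / 2 : ℝ) * ENNReal.ofReal t ^ (1 / 4 : ℝ) := add_le_add hcube hpress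
          _ = Wtop * ENNReal.ofReal t ^ (1 / 4 : ℝ) := by rw [hWtop]; ring
      -- the real arithmetic
      have h3 : Wtop * ENNReal.ofReal t ^ (1 / 4 : ℝ) ≤ ENNReal.ofReal θ := by
        rw [hWeq, ENNReal.ofReal_rpow_of_nonneg ht.1.le (by norm_num), ← ENNReal.ofReal_mul hW0]
        refine ENNReal.ofReal_le_ofReal ?_
        have htτ : t ≤ τ := ht.2.trans hT₀τ
        have h4 : t ^ (1 / 4 : ℝ) ≤ θ / (W + 1) := by
          calc t ^ (1 / 4 : ℝ) ≤ τ ^ (1 / 4 : ℝ) := Real.rpow_le_rpow ht.1.le htτ (by norm_num)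
            _ = θ / (W + 1) := by
                rw [hτ, ← Real.rpow_natCast, ← Real.rpow_mul (by positivity)]
                norm_num
        calc W * t ^ (1 / 4 : ℝ) ≤ W * (θ / (W + 1)) := mul_le_mul_of_nonneg_left h4 hW0
          _ ≤ θ := by
              rw [mul_div_assoc']
              rw [div_le_iff₀ (by positivity)]
              nlinarith
      have h5 : ENNReal.ofReal (A₀ ^ 3) * (ENNReal.ofReal (r ^ 2 * r ^ 3) * V₁e) ≤ ENNReal.ofReal θ := by
        rw [show V₁e = ENNReal.ofReal V₁ from hV₁eq, ← ENNReal.ofReal_mul (by positivity), ← ENNReal.ofReal_mul (by positivity)]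
        refine ENNReal.ofReal_le_ofReal ?_
        have : A₀ ^ 3 * (r ^ 2 * r ^ 3 * V₁) = (A₀ ^ 3 * V₁ * r ^ 3) * r ^ 2 := by ring
        rw [this, hθ]
        have hr2 : 0 ≤ r ^ 2 := sq_nonneg _
        nlinarith
      calc ∫⁻ w in FluidPDE.parabolicCylinder r (t, x), (‖uc w.1 w.2‖ₑ ^ (3 : ℕ) + ‖pc w.1 w.2‖ₑ ^ (3 / 2 : ℝ))
          ≤ ENNReal.ofReal θ + ENNReal.ofReal θ := h1.trans (add_le_add h5 (h2.trans h3))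
        _ = ENNReal.ofReal (ε₀ ^ 3 * r ^ 2) := by
            rw [← ENNReal.ofReal_add hθ0.le hθ0.le, hθ]
            congr 1
            ring
    -- ## smallness of the force functional
    have hsmall₂ : ∫⁻ w in FluidPDE.parabolicCylinder r (t, x), ‖fc w.1 w.2‖ₑ ^ (3 : ℝ) ≤
        ENNReal.ofReal (ε₀ ^ (2 * (3 : ℝ)) * r ^ (5 - 3 * (3 : ℝ))) := by
      have h1 := lintegral_cylinder_force_le (t := t) (fc := fc) hr0.le
        (fun y hy => hF₀ y (hballr hy)) hf₁ hf₂
      refine h1.trans ?_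
      rw [show volume (ball (0 : EuclideanSpace ℝ (Fin 3)) 1) = V₁e from rfl, hV₁eq,
        ← ENNReal.ofReal_mul (by positivity), ← ENNReal.ofReal_mul (by positivity)]
      refine ENNReal.ofReal_le_ofReal ?_
      have e6 : ε₀ ^ (2 * (3 : ℝ)) = ε₀ ^ 6 := by
        rw [show (2 * (3 : ℝ)) = ((6 : ℕ) : ℝ) by norm_num, Real.rpow_natCast]
      have e4 : r ^ (5 - 3 * (3 : ℝ)) = (r ^ 4)⁻¹ := by
        rw [show (5 - 3 * (3 : ℝ)) = -((4 : ℕ) : ℝ) by norm_num, Real.rpow_neg hr0.le, Real.rpow_natCast]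
      rw [e6, e4, ← div_eq_mul_inv, le_div_iff₀ (by positivity)]
      have : F₀ ^ 3 * (r ^ 2 * r ^ 3 * V₁) * r ^ 4 = F₀ ^ 3 * V₁ * r ^ 9 := by ring
      rw [this]
      exact hF9
    -- ## Lemarié-Rieusset's theorem on the continued pair
    have happ := hLR (TopologicalSpace.Opens.mk (Ioo (-1 : ℝ) T₀ ×ˢ ball x₀ (15 / 4))
        (isOpen_Ioo.prod isOpen_ball)) fc uc pc Gc
      (isConnected_Q hT₀0 hρ) (exists_energyClass_Q hq hT₀T hρ hA₀' hu₁ hu₂)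
      (hasWeakSpatialGradientOn_Q hq hT₀0.le hT₀T he1 hG hGb hu₁ hu₂ hG₁ hG₂)
      (lintegral_Gc_sq_lt_top hT₀0.le hT₀T hρ he1 hGb hG₁ hG₂)
      (lintegral_pc_lt_top hq hT₀T hp₁ hp₂) (memLp_fc he (fun y hy => hF₀ y hy) hf₁ hf₂)
      (isDistributionalNSSolutionOn_Q hq hm₀ hT₀0 hT₀T he heu hdiv hu₁ hu₂ hp₁ hp₂ hf₁ hf₂)
      (fun φ hφ hφ0 => localEnergyIneq_Q hq hm₀ hT₀0 hT₀T he heu hdiv hG hGb hu₁ hu₂ hp₁ hp₂ hf₁ hf₂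
        hG₁ hG₂ hφ hφ0)
      (t, x) r ε₀ hr0 hcyl hε₀.le le_rfl hsmall₁ hsmall₂
    -- back to `u`
    have happ' := (ae_restrict_iff' (FluidPDE.isOpen_parabolicCylinder (r / 2) (t, x)).measurableSet).1 happ
    filter_upwards [happ'] with w hw hwmem hw0
    have := hw hwmem
    rwa [hu₂ w.1 hw0] at this
  -- ## covering by countably many cylinders
  obtain ⟨S, hSc, hSd⟩ := TopologicalSpace.exists_countable_dense (EuclideanSpace ℝ (Fin 3))
  set I : Set (ℚ × EuclideanSpace ℝ (Fin 3)) := {i | (i.1 : ℝ) ∈ Ioc 0 T₀ ∧ i.2 ∈ S ∩ ball x₀ (13 / 4)} with hI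
  have hIc : I.Countable := by
    have : I ⊆ (univ : Set ℚ) ×ˢ S := fun i hi => ⟨mem_univ _, hi.2.1⟩
    exact ((countable_univ).prod hSc).mono this
  have hall : ∀ᵐ w ∂(volume : Measure (ℝ × EuclideanSpace ℝ (Fin 3))), ∀ i ∈ I,
      w ∈ FluidPDE.parabolicCylinder (r / 2) ((i.1 : ℝ), i.2) → 0 < w.1 → ‖u w.1 w.2‖ ≤ C₀ * ε₀ / r := by
    rw [ae_ball_iff hIc]
    rintro ⟨q, y⟩ ⟨hq, hy⟩
    exact key q y hq hy.2
  filter_upwards [ae_restrict_mem (measurableSet_Ioo.prod measurableSet_ball), ae_restrict_of_ae hall]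
    with w hw hallw
  -- a centre near `w.2` and a rational time just above `w.1`
  obtain ⟨y, hyS, hyw⟩ := hSd.exists_dist_lt w.2 (half_pos hr0)
  have hy : y ∈ ball x₀ (13 / 4) := by
    rw [mem_ball]
    calc dist y x₀ ≤ dist y w.2 + dist w.2 x₀ := dist_triangle _ _ _
      _ < r / 2 + 3 := by rw [dist_comm]; exact add_lt_add hyw (mem_ball.1 hw.2)
      _ ≤ 13 / 4 := by linarith
  have hwT : w.1 < min T₀ (w.1 + (r / 2) ^ 2) := lt_min hw.1.2 (by nlinarith)
  obtain ⟨q, hq1, hq2⟩ := exists_rat_btwn hwT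
  have hqI : ((q, y) : ℚ × EuclideanSpace ℝ (Fin 3)) ∈ I :=
    ⟨⟨hw.1.1.trans hq1, (hq2.trans_le (min_le_left _ _)).le⟩, hyS, hy⟩
  refine hallw (q, y) hqI ?_ hw.1.1
  rw [FluidPDE.mem_parabolicCylinder]
  refine ⟨⟨?_, hq1⟩, ?_⟩
  · have := hq2.trans_le (min_le_right _ _)
    show (q : ℝ) - (r / 2) ^ 2 < w.1
    linarith
  · show dist w.2 y < r / 2
    exact hyw

end Main

end JiaSverak2014

end Literature.Analysis.FluidPDE
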